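import Summits.Langlands.Langlands.Theorems.SqrtFiveQuarticCoversE7DescentW5Gcd
import Mathlib.Data.Int.Lemmas

/-!
# Route `Langlands/SqrtFiveQuarticCovers`, sheet 4.5 row 8 — `1225.c1(ℚ) ≅ ℤ/2` IN THE KERNEL

`W⁵ : y² = x(x² + 1470x − 8575) = x³ + 1470x² − 8575x` is the quadratic twist of `W = 49a4` by `5`
(minimal model `[1,−1,1,−45555,3753572]` = LMFDB `1225.c1`, anchor `e7_W5_variableChange` of
p677449).  MAIN THEOREM `W5_affinePoints : ∀ x y : ℚ, y² = x(x² + 1470x − 8575) → x = 0` (`W⁵(ℚ) =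
{O, (0,0)}`) — a SECOND, method-different kernel proof of the named input `hQ5` of
`…CertB3E7MordellWeilQ.lean`, whose declaration of record is eng-7 g5's `W5Descent.ratPoints`
(p680761; 2-isogeny descent + the tree's Mordell–Weil theorem); this file uses Fermat's numerator
descent instead (no Mordell–Weil, no heights, no group law).

PROOF SKELETON — identical to `…E7DescentW.lean` (complete 2-isogeny descent + Fermat descent on
the numerator; no Mordell–Weil, no heights, no group law):
1. CLASS (`W5_sq_or_transl_sq`, module `…W5Local`): `x ≠ 0` ⇒ `x = r²` or `−8575/x = r²`.
2. HALVING (`W5_halve`, `W5_descent_step`): class-1 `x = M²/e²` ⇒ `ψ`-halve to `W⁵'`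
   (`X = 1470 + 2w² + 2y/w`), normalise by `W5p_sq_or_transl_sq` (translation `X ↦ 2195200/X`),
   `φ`-halve back, normalise by `W5_sq_or_transl_sq` (translation `x ↦ −8575/x`), lowest terms
   `(M₁, e₁, N₁)` COPRIME (`descent_triple_of_sq`), and `x = ((M₁⁴ + 8575e₁⁴)/(2M₁N₁e₁))²`
   (`W5_xpsi_xphi`).
3. THE ONE INEQUALITY: `M₁⁴ + 8575e₁⁴ = M·g`, `g ∣ 2M₁e₁|N₁|`, and `W5_gcd_bound`: `g ∣ 137200 =
   2⁴5²7³` (Bezout identities put `g ∣ 2⁸5⁴7⁶`; trims: `v₂ ≤ 4` because for odd `M, e` the quartic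
   `Q = (M² + 735e²)² − 548800e⁴` is never `0 mod 256` (`ZMod 256` certificate on `S² = 192`),
   `5³ ∤ M⁴ + 8575e⁴`, `7⁴ ∤ M⁴ + 8575e⁴`).  So `M₁⁴ + 8575e₁⁴ ≤ 137200·M`.
4. FERMAT (`W5_no_classOne`): minimal `M` has `M⁴ + 8575 ≤ 137200M`, i.e. `M ≤ 51`, and `12e ≤ 5M`;
   the candidates are excluded by `norm_num`'s `IsSquare` extension (`W5_finite_check`, eight chunks).

HONEST STATUS: elementary, kernel-checked `E(ℚ)` of ONE explicit elliptic curve (LMFDB `1225.c1`,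
Cremona database: `r = 0`, `|T| = 2`); not a modularity or BSD statement; nothing here proves
modularity of a new class.  References: Silverman–Tate III.4–III.6; kit j319940/j320107/j320342.
-/

set_option linter.dupNamespace false -- project-wide option; `Summit.Langlands.Langlands` is the mandated namespace

namespace Summit.Langlands.Langlands.Theorems.SqrtFiveQuarticCovers

/-! ### §2 The descent step -/

/-- `x_ψ ∘ x_φ` on `W⁵`: `= (t² + 8575)²/(4t(t² + 1470t − 8575))`. [folklore] -/
theorem W5_xpsi_xphi (t : ℚ) (ht : t ≠ 0) :
    (((t ^ 2 + 1470 * t - 8575) / t) ^ 2 - 2940 * ((t ^ 2 + 1470 * t - 8575) / t) + 2195200)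
        / (4 * ((t ^ 2 + 1470 * t - 8575) / t))
      = (t ^ 2 + 8575) ^ 2 / (4 * (t * (t ^ 2 + 1470 * t - 8575))) := by
  field_simp
  ring

/-- **Halving, normalised** (as `W_halve`, constants of `W⁵`). [folklore] -/
theorem W5_halve {x y w : ℚ} (hxw : x = w ^ 2) (hw : w ≠ 0)
    (hy : y ^ 2 = x * (x ^ 2 + 1470 * x - 8575)) :
    ∃ xh yh rh : ℚ, rh ≠ 0 ∧ xh = rh ^ 2 ∧ yh ^ 2 = xh * (xh ^ 2 + 1470 * xh - 8575) ∧
      xh ^ 2 + 1470 * xh - 8575 ≠ 0 ∧ x = (xh ^ 2 + 8575) ^ 2 / (4 * (xh * (xh ^ 2 + 1470 * xh - 8575))) := by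
  have hyc : y ^ 2 = x * (x ^ 2 + (1470 : ℚ) * x + (-8575 : ℚ)) := by linear_combination hy
  obtain ⟨hX0, hYc, hxψ⟩ :=
    descent_psi_halve (a := (1470 : ℚ)) (b := (-8575 : ℚ)) (by norm_num) hxw hw hyc
  set X : ℚ := 1470 + 2 * w ^ 2 + 2 * (y / w) with hXdef
  have hYc' : (2 * w * X) ^ 2 = X * (X ^ 2 - 2940 * X + 2195200) := by rw [hYc]; ring
  have hxψ' : (X ^ 2 - 2940 * X + 2195200) / (4 * X) = x := by rw [← hxψ]; ring
  obtain ⟨Xh, Yh, Rh, hRh, hXh, hYh, hψh⟩ : ∃ Xh Yh Rh : ℚ, Rh ≠ 0 ∧ Xh = Rh ^ 2 ∧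
      Yh ^ 2 = Xh * (Xh ^ 2 - 2940 * Xh + 2195200) ∧ (Xh ^ 2 - 2940 * Xh + 2195200) / (4 * Xh) = x := by
    rcases W5p_sq_or_transl_sq hX0 hYc' with ⟨R, hR0, hXR⟩ | ⟨R, hR0, hXR⟩
    · exact ⟨X, 2 * w * X, R, hR0, hXR, hYc', hxψ'⟩
    · refine ⟨2195200 / X, 2195200 * (2 * w * X) / X ^ 2, R, hR0, hXR, ?_, ?_⟩
      · have h := descent_transl_onCurve (-2940 : ℚ) 2195200 hX0 (y := 2 * w * X) (by rw [hYc']; ring)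
        rw [h]; ring
      · rw [← hxψ']
        field_simp
        ring
  have hXh0 : Xh ≠ 0 := by rw [hXh]; exact pow_ne_zero 2 hRh
  have hYh' : Yh ^ 2 = Xh * (Xh ^ 2 - 2 * (1470 : ℚ) * Xh + ((1470 : ℚ) ^ 2 - 4 * (-8575 : ℚ))) := by
    rw [hYh]; ring
  obtain ⟨hx1, hy1, hφ1⟩ :=
    descent_phi_halve (a := (1470 : ℚ)) (b := (-8575 : ℚ)) (by norm_num) hXh hRh hYh'
  set x₁ : ℚ := (Rh ^ 2 - 1470 + Yh / Rh) / 2 with hx₁def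
  have hy1' : (Rh * x₁) ^ 2 = x₁ * (x₁ ^ 2 + 1470 * x₁ - 8575) := by rw [hy1]; ring
  have hφ1' : (x₁ ^ 2 + 1470 * x₁ - 8575) / x₁ = Xh := by rw [← hφ1]; ring
  obtain ⟨xh, yh, rh, hrh, hxh, hyh, hφh⟩ : ∃ xh yh rh : ℚ, rh ≠ 0 ∧ xh = rh ^ 2 ∧
      yh ^ 2 = xh * (xh ^ 2 + 1470 * xh - 8575) ∧ (xh ^ 2 + 1470 * xh - 8575) / xh = Xh := by
    rcases W5_sq_or_transl_sq hx1 hy1' with ⟨r, hr0, hxr⟩ | ⟨r, hr0, hxr⟩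
    · exact ⟨x₁, Rh * x₁, r, hr0, hxr, hy1', hφ1'⟩
    · refine ⟨-8575 / x₁, -8575 * (Rh * x₁) / x₁ ^ 2, r, hr0, hxr, ?_, ?_⟩
      · have h := descent_transl_onCurve (1470 : ℚ) (-8575) hx1 (y := Rh * x₁) (by rw [hy1']; ring)
        rw [h]; ring
      · rw [← hφ1']
        field_simp
        ring
  have hxh0 : xh ≠ 0 := by rw [hxh]; exact pow_ne_zero 2 hrh
  have hq0 : xh ^ 2 + 1470 * xh - 8575 ≠ 0 := by
    intro h0
    apply hXh0
    rw [← hφh, h0, zero_div]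
  refine ⟨xh, yh, rh, hrh, hxh, hyh, hq0, ?_⟩
  rw [← hψh, ← hφh, W5_xpsi_xphi xh hxh0]

/-- **The descent step with the height inequality** on `W⁵`: a class-1 triple `(M, e, N)` yields a
class-1 triple `(M₁, e₁, N₁)` with `M₁⁴ + 8575e₁⁴ ≤ 137200·M`. [folklore] -/
theorem W5_descent_step {M e : ℕ} {N : ℤ} (hM : 0 < M) (he : 0 < e) (hcop : Nat.Coprime M e)
    (hN : N ^ 2 = (M : ℤ) ^ 4 + 1470 * M ^ 2 * e ^ 2 - 8575 * e ^ 4) :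
    ∃ (M₁ e₁ : ℕ) (N₁ : ℤ), 0 < M₁ ∧ 0 < e₁ ∧ Nat.Coprime M₁ e₁ ∧
      N₁ ^ 2 = (M₁ : ℤ) ^ 4 + 1470 * M₁ ^ 2 * e₁ ^ 2 - 8575 * e₁ ^ 4 ∧
      M₁ ^ 4 + 8575 * e₁ ^ 4 ≤ 137200 * M := by
  have hMQ : (M : ℚ) ≠ 0 := by positivity
  have heQ : (e : ℚ) ≠ 0 := by positivity
  have hNQ : ((N : ℚ)) ^ 2 = (M : ℚ) ^ 4 + 1470 * (M : ℚ) ^ 2 * (e : ℚ) ^ 2 - 8575 * (e : ℚ) ^ 4 := by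
    exact_mod_cast hN
  have hxw : (M : ℚ) ^ 2 / (e : ℚ) ^ 2 = ((M : ℚ) / e) ^ 2 := by rw [div_pow]
  have hyc : ((M : ℚ) * N / (e : ℚ) ^ 3) ^ 2 =
      ((M : ℚ) ^ 2 / (e : ℚ) ^ 2) * (((M : ℚ) ^ 2 / (e : ℚ) ^ 2) ^ 2 + 1470 * ((M : ℚ) ^ 2 / (e : ℚ) ^ 2) - 8575) := by
    rw [div_pow, mul_pow, hNQ]
    field_simp
  obtain ⟨xh, yh, rh, hrh, hxh, hyh, hq0, hxrel⟩ := W5_halve hxw (div_ne_zero hMQ heQ) hyc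
  have hyh' : yh ^ 2 = xh * (xh ^ 2 + ((1470 : ℤ) : ℚ) * xh + ((-8575 : ℤ) : ℚ)) := by
    push_cast; linear_combination hyh
  obtain ⟨M₁, e₁, N₁, hM₁, he₁, hcop₁, hxh₁, hN₁⟩ := descent_triple_of_sq hrh hxh hyh'
  have hN₁' : N₁ ^ 2 = (M₁ : ℤ) ^ 4 + 1470 * M₁ ^ 2 * e₁ ^ 2 - 8575 * e₁ ^ 4 := by linear_combination hN₁
  refine ⟨M₁, e₁, N₁, hM₁, he₁, hcop₁, hN₁', ?_⟩
  have hM₁Q : (M₁ : ℚ) ≠ 0 := by positivity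
  have he₁Q : (e₁ : ℚ) ≠ 0 := by positivity
  have hN₁Q : ((N₁ : ℚ)) ^ 2 = (M₁ : ℚ) ^ 4 + 1470 * (M₁ : ℚ) ^ 2 * (e₁ : ℚ) ^ 2 - 8575 * (e₁ : ℚ) ^ 4 := by
    exact_mod_cast hN₁'
  have hN₁0 : (N₁ : ℚ) ≠ 0 := by
    intro h0
    apply hq0
    rw [hxh₁]
    field_simp
    have : (M₁ : ℚ) ^ 4 + 1470 * (M₁ : ℚ) ^ 2 * (e₁ : ℚ) ^ 2 - 8575 * (e₁ : ℚ) ^ 4 = 0 := by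
      rw [← hN₁Q, h0]; ring
    linear_combination this
  have hq : xh * (xh ^ 2 + 1470 * xh - 8575) = (M₁ : ℚ) ^ 2 * (N₁ : ℚ) ^ 2 / (e₁ : ℚ) ^ 6 := by
    rw [hxh₁, hN₁Q]
    field_simp
  have hnum : xh ^ 2 + 8575 = ((M₁ : ℚ) ^ 4 + 8575 * (e₁ : ℚ) ^ 4) / (e₁ : ℚ) ^ 4 := by
    rw [hxh₁]
    field_simp
  have hkey : ((M : ℚ) ^ 2 / (e : ℚ) ^ 2) * (2 * (M₁ : ℚ) * N₁ * e₁) ^ 2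
      = ((M₁ : ℚ) ^ 4 + 8575 * (e₁ : ℚ) ^ 4) ^ 2 := by
    rw [hxrel, hq, hnum]
    field_simp
    ring
  have hQ2 : ((M : ℚ) * (2 * (M₁ : ℚ) * N₁ * e₁)) ^ 2 = ((e : ℚ) * ((M₁ : ℚ) ^ 4 + 8575 * (e₁ : ℚ) ^ 4)) ^ 2 := by
    have h0 : ((M : ℚ) * (2 * (M₁ : ℚ) * N₁ * e₁)) ^ 2
        = (e : ℚ) ^ 2 * ((M : ℚ) ^ 2 / (e : ℚ) ^ 2 * (2 * (M₁ : ℚ) * N₁ * e₁) ^ 2) := by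
      field_simp
    rw [h0, hkey]
    ring
  have hZ : ((M : ℤ) * (2 * M₁ * N₁ * e₁)) ^ 2 = ((e : ℤ) * ((M₁ : ℤ) ^ 4 + 8575 * e₁ ^ 4)) ^ 2 := by
    exact_mod_cast hQ2
  have hNat : M * (2 * M₁ * e₁ * N₁.natAbs) = e * (M₁ ^ 4 + 8575 * e₁ ^ 4) := by
    have h1 := Int.natAbs_eq_iff_sq_eq.mpr hZ
    have h2 : ((M : ℤ) * (2 * M₁ * N₁ * e₁)).natAbs = M * (2 * M₁ * e₁ * N₁.natAbs) := by
      rw [show (M : ℤ) * (2 * M₁ * N₁ * e₁) = ((M * (2 * M₁ * e₁) : ℕ) : ℤ) * N₁ by push_cast; ring,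
        Int.natAbs_mul, Int.natAbs_natCast]
      ring
    have h3 : ((e : ℤ) * ((M₁ : ℤ) ^ 4 + 8575 * e₁ ^ 4)).natAbs = e * (M₁ ^ 4 + 8575 * e₁ ^ 4) := by
      rw [show (e : ℤ) * ((M₁ : ℤ) ^ 4 + 8575 * e₁ ^ 4) = ((e * (M₁ ^ 4 + 8575 * e₁ ^ 4) : ℕ) : ℤ) by
        push_cast; ring, Int.natAbs_natCast]
    rw [h2, h3] at h1
    exact h1
  have hMA : M ∣ M₁ ^ 4 + 8575 * e₁ ^ 4 :=
    hcop.dvd_of_dvd_mul_left ⟨2 * M₁ * e₁ * N₁.natAbs, hNat.symm⟩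
  obtain ⟨g, hg⟩ := hMA
  have hgB : g ∣ 2 * M₁ * e₁ * N₁.natAbs := by
    refine ⟨e, ?_⟩
    have : M * (2 * M₁ * e₁ * N₁.natAbs) = M * (g * e) := by rw [hNat, hg]; ring
    exact Nat.eq_of_mul_eq_mul_left hM this
  have hg137200 : g ∣ 137200 := W5_gcd_bound hcop₁ hN₁' ⟨M, by rw [hg]; ring⟩ hgB
  have hgle : g ≤ 137200 := Nat.le_of_dvd (by norm_num) hg137200
  calc M₁ ^ 4 + 8575 * e₁ ^ 4 = M * g := hg
    _ ≤ M * 137200 := Nat.mul_le_mul_left M hgle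
    _ = 137200 * M := by ring

/-! ### §3 Fermat's descent and the finite check -/

/-- Finite check, `1 ≤ M ≤ 7` (`e ≤ 2`). [folklore] -/
theorem W5_finite_check_1 : ∀ M e : ℕ, 1 ≤ M → M ≤ 7 → e ≤ 2 → 0 < e →
    ¬ IsSquare ((M : ℤ) ^ 4 + 1470 * M ^ 2 * e ^ 2 - 8575 * e ^ 4) := by
  intro M e hM1 hM he he0
  interval_cases M <;> interval_cases e <;> norm_num

/-- Finite check, `8 ≤ M ≤ 13` (`e ≤ 5`). [folklore] -/
theorem W5_finite_check_2 : ∀ M e : ℕ, 8 ≤ M → M ≤ 13 → e ≤ 5 → 0 < e →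
    ¬ IsSquare ((M : ℤ) ^ 4 + 1470 * M ^ 2 * e ^ 2 - 8575 * e ^ 4) := by
  intro M e hM1 hM he he0
  interval_cases M <;> interval_cases e <;> norm_num

/-- Finite check, `14 ≤ M ≤ 20` (`e ≤ 8`). [folklore] -/
theorem W5_finite_check_3 : ∀ M e : ℕ, 14 ≤ M → M ≤ 20 → e ≤ 8 → 0 < e →
    ¬ IsSquare ((M : ℤ) ^ 4 + 1470 * M ^ 2 * e ^ 2 - 8575 * e ^ 4) := by
  intro M e hM1 hM he he0
  interval_cases M <;> interval_cases e <;> norm_num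

/-- Finite check, `21 ≤ M ≤ 26` (`e ≤ 10`). [folklore] -/
theorem W5_finite_check_4 : ∀ M e : ℕ, 21 ≤ M → M ≤ 26 → e ≤ 10 → 0 < e →
    ¬ IsSquare ((M : ℤ) ^ 4 + 1470 * M ^ 2 * e ^ 2 - 8575 * e ^ 4) := by
  intro M e hM1 hM he he0
  interval_cases M <;> interval_cases e <;> norm_num

/-- Finite check, `27 ≤ M ≤ 33` (`e ≤ 13`). [folklore] -/
theorem W5_finite_check_5 : ∀ M e : ℕ, 27 ≤ M → M ≤ 33 → e ≤ 13 → 0 < e →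
    ¬ IsSquare ((M : ℤ) ^ 4 + 1470 * M ^ 2 * e ^ 2 - 8575 * e ^ 4) := by
  intro M e hM1 hM he he0
  interval_cases M <;> interval_cases e <;> norm_num

/-- Finite check, `34 ≤ M ≤ 39` (`e ≤ 16`). [folklore] -/
theorem W5_finite_check_6 : ∀ M e : ℕ, 34 ≤ M → M ≤ 39 → e ≤ 16 → 0 < e →
    ¬ IsSquare ((M : ℤ) ^ 4 + 1470 * M ^ 2 * e ^ 2 - 8575 * e ^ 4) := by
  intro M e hM1 hM he he0
  interval_cases M <;> interval_cases e <;> norm_num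

/-- Finite check, `40 ≤ M ≤ 45` (`e ≤ 18`). [folklore] -/
theorem W5_finite_check_7 : ∀ M e : ℕ, 40 ≤ M → M ≤ 45 → e ≤ 18 → 0 < e →
    ¬ IsSquare ((M : ℤ) ^ 4 + 1470 * M ^ 2 * e ^ 2 - 8575 * e ^ 4) := by
  intro M e hM1 hM he he0
  interval_cases M <;> interval_cases e <;> norm_num

/-- Finite check, `46 ≤ M ≤ 51` (`e ≤ 21`). [folklore] -/
theorem W5_finite_check_8 : ∀ M e : ℕ, 46 ≤ M → M ≤ 51 → e ≤ 21 → 0 < e →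
    ¬ IsSquare ((M : ℤ) ^ 4 + 1470 * M ^ 2 * e ^ 2 - 8575 * e ^ 4) := by
  intro M e hM1 hM he he0
  interval_cases M <;> interval_cases e <;> norm_num

/-- The finite check: for `1 ≤ M ≤ 51`, `1 ≤ e`, `12e ≤ 5M`, `M⁴ + 1470M²e² − 8575e⁴` is not a
perfect square (`norm_num`'s `IsSquare` extension, eight chunks). [folklore] -/
theorem W5_finite_check : ∀ M e : ℕ, M ≤ 51 → 12 * e ≤ 5 * M → 0 < M → 0 < e →
    ¬ IsSquare ((M : ℤ) ^ 4 + 1470 * M ^ 2 * e ^ 2 - 8575 * e ^ 4) := by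
  intro M e hM h12e hM0 he0
  by_cases h1 : M ≤ 7
  · exact W5_finite_check_1 M e (by omega) h1 (by omega) he0
  by_cases h2 : M ≤ 13
  · exact W5_finite_check_2 M e (by omega) h2 (by omega) he0
  by_cases h3 : M ≤ 20
  · exact W5_finite_check_3 M e (by omega) h3 (by omega) he0
  by_cases h4 : M ≤ 26
  · exact W5_finite_check_4 M e (by omega) h4 (by omega) he0
  by_cases h5 : M ≤ 33
  · exact W5_finite_check_5 M e (by omega) h5 (by omega) he0
  by_cases h6 : M ≤ 39
  · exact W5_finite_check_6 M e (by omega) h6 (by omega) he0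
  by_cases h7 : M ≤ 45
  · exact W5_finite_check_7 M e (by omega) h7 (by omega) he0
  · exact W5_finite_check_8 M e (by omega) hM (by omega) he0

/-- **No class-1 points on `W⁵` (Fermat descent on the numerator `M`).** [folklore] -/
theorem W5_no_classOne : ∀ (M e : ℕ) (N : ℤ), 0 < M → 0 < e → Nat.Coprime M e →
    N ^ 2 = (M : ℤ) ^ 4 + 1470 * M ^ 2 * e ^ 2 - 8575 * e ^ 4 → False := by
  intro M
  induction M using Nat.strong_induction_on with
  | _ M ih =>
    intro e N hM he hcop hN
    obtain ⟨M₁, e₁, N₁, hM₁, he₁, hcop₁, hN₁, hle⟩ := W5_descent_step hM he hcop hN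
    by_cases hlt : M₁ < M
    · exact ih M₁ hlt e₁ N₁ hM₁ he₁ hcop₁ hN₁
    · have hMM : M ≤ M₁ := not_lt.mp hlt
      have hM4 : M ^ 4 + 8575 ≤ 137200 * M := by
        have h1 : M ^ 4 ≤ M₁ ^ 4 := Nat.pow_le_pow_left hMM 4
        have h2 : 8575 ≤ 8575 * e₁ ^ 4 := Nat.le_mul_of_pos_right _ (by positivity)
        omega
      have hM51 : M ≤ 51 := by
        by_contra h
        have h52 : 52 ≤ M := by omega
        have : 140608 * M ≤ M ^ 4 := by
          calc 140608 * M = 52 ^ 3 * M := by norm_num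
            _ ≤ M ^ 3 * M := Nat.mul_le_mul_right M (Nat.pow_le_pow_left h52 3)
            _ = M ^ 4 := by ring
        omega
      -- `12e ≤ 5M` from `N² ≥ 0` (`M/e > 2.41`)
      have h12e : 12 * e ≤ 5 * M := by
        by_contra h
        have hlt : 5 * (M : ℤ) ≤ 12 * e := by exact_mod_cast (by omega : 5 * M ≤ 12 * e)
        have hM0' : (0 : ℤ) ≤ M := by positivity
        have hA : 25 * (M : ℤ) ^ 2 ≤ 144 * (e : ℤ) ^ 2 := by nlinarith
        have hC : 25 * ((M : ℤ) ^ 2 * (e : ℤ) ^ 2) ≤ 144 * (e : ℤ) ^ 4 := by nlinarith [sq_nonneg (e : ℤ)]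
        have hB : 625 * (M : ℤ) ^ 4 ≤ 20736 * (e : ℤ) ^ 4 := by nlinarith [hA, sq_nonneg (M : ℤ)]
        have h3 : (0 : ℤ) ≤ N ^ 2 := sq_nonneg N
        have h4 : (0 : ℤ) < (e : ℤ) ^ 4 := by positivity
        nlinarith [hB, hC, h3, h4, hN]
      exact W5_finite_check M e hM51 h12e hM he ⟨N, by rw [← sq]; exact hN.symm⟩

/-! ### §4 `W⁵(ℚ) = {O, T}` — second, method-different proof -/

/-- **`1225.c1(ℚ)_aff = {(0,0)}` (factored form): every rational affine point of
`y² = x(x² + 1470x − 8575)` has `x = 0`.**  A SECOND, method-different kernel proof of the content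
of eng-7 g5's `W5Descent.ratPoints` (p680761, `…W5DescentRatPoints.lean`: 2-isogeny descent + the
tree's Mordell–Weil theorem + torsion integrality): here by Fermat's numerator descent
(`W5_no_classOne`) — no Mordell–Weil, no heights.  (Cremona database / LMFDB `1225.c1`: `r = 0`,
`|T| = 2`.) [folklore] -/
theorem W5_affinePoints : ∀ x y : ℚ, y ^ 2 = x * (x ^ 2 + 1470 * x - 8575) → x = 0 := by
  intro x y hy
  by_contra hx
  obtain ⟨xh, yh, r, hr, hxr, hyh⟩ : ∃ xh yh r : ℚ, r ≠ 0 ∧ xh = r ^ 2 ∧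
      yh ^ 2 = xh * (xh ^ 2 + 1470 * xh - 8575) := by
    rcases W5_sq_or_transl_sq hx hy with ⟨r, hr, hxr⟩ | ⟨r, hr, hxr⟩
    · exact ⟨x, y, r, hr, hxr, hy⟩
    · refine ⟨-8575 / x, -8575 * y / x ^ 2, r, hr, hxr, ?_⟩
      have := descent_transl_onCurve (1470 : ℚ) (-8575) hx (y := y) (by rw [hy]; ring)
      rw [this]; ring
  have hyh' : yh ^ 2 = xh * (xh ^ 2 + ((1470 : ℤ) : ℚ) * xh + ((-8575 : ℤ) : ℚ)) := by
    push_cast; linear_combination hyh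
  obtain ⟨M, e, N, hM, he, hcop, -, hN⟩ := descent_triple_of_sq hr hxr hyh'
  exact W5_no_classOne M e N hM he hcop (by linear_combination hN)

end Summit.Langlands.Langlands.Theorems.SqrtFiveQuarticCovers
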